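import Summits.ResolutionOfSingularities.ResolutionOfSingularities.Theorems.FrobeniusLadderFInjectiveMacaulayficationFTemkinClosedPointsFibre
import Summits.ResolutionOfSingularities.ResolutionOfSingularities.Theorems.FrobeniusLadderFInjectiveMacaulayficationLocalFullificationFibreClosedGe4
import Summits.ResolutionOfSingularities.ResolutionOfSingularities.Theorems.FrobeniusLadderFInjectiveMacaulayficationLocalFullificationDimFourFibreSplit
import Summits.ResolutionOfSingularities.ResolutionOfSingularities.Theorems.FrobeniusLadderFInjectiveMacaulayficationRegularBlowupModelDim2
import Summits.ResolutionOfSingularities.ResolutionOfSingularities.Theorems.FrobeniusLadderFInjectiveMacaulayficationRelClosedSubsetFixFinite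
import HarnessLib

/-!
# THE CM / F SPLIT OF THE REGISTERED RESIDUE (LF_cl) `LocalFullificationFibreClosedGe4` OF DOOR v36 «LocalDoor»: (LF_cl) ⟺ (LF_cl-CM) ∧ (LF_cl-F)
# (crux `FInjectiveMacaulayfication` stmt-ResolutionOfSingularities-15315, chain w45a; the `ClosedGe4` twin of this seat's p587643
# `LocalFullificationDimFourFibreSplit` (d = 4) and of res-L1-w45a-stub-1's N1 `LocalFullificationFibreGe4Split` (all d, all points), by the same single
# substitutions; res-L1-w45a-plan-1 R17.6; seat res-L1-w45a-stub-2 g6)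

[OURS · L1 W4.5a] Support file (`--supports stmt-ResolutionOfSingularities-15315 --as helper`); TWO `Prop`-valued CANDIDATE statements of OURS
(`@[conjecture] def`, consumed only as hypotheses; no instance, no notation, no named fact) and the PROVED equivalence with (LF_cl); replaces the role
of NO printed item; NOT a statement of the manuscript; AI-written (AI review is weaker than expert review).

WHY THIS LEVEL. Door v36 registers the WEAKEST local F-side statement, (LF_cl) `LocalFullificationFibreClosedGe4.LocalFullificationFibreClosedGe4`
(p588526: for every `d ≥ 4`, every CLOSED point `x` of local dimension `d` of an integral variety `X/k`, every blowing up `S′ → Spec 𝒪_{X,x}` along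
`I ≠ ⊥` regular off its closed fibre has a fibre-supported centre all of whose blowings up are FULL everywhere). Splitting it HERE puts the instance
programme's target (the F-half) at exactly the registered level:
* (LF_cl-CM) `LocalMacaulayficationFibreClosedGe4` — conclusion «domain ∧ CM-clause» only: fibre-supported MACAULAYFICATION of `S′` — an instance of
  [Česnavičius 2021, Thm. 1.6 / Thm. 5.3: blow-up Macaulayfication with centre disjoint from the CM locus] since `S′` is regular (so CM) off the
  closed fibre — KNOWN IN PRINT, candidate-tagged OURS until a named fact is filed;
* (LF_cl-F) `LocalFInjectivizationFibreClosedGe4` — (LF_cl) with the EXTRA hypothesis `∀ s, CMCl 𝒪_{S′,s}`: «a Cohen–Macaulay integral `d`-dimensional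
  local blow-up scheme over a CLOSED point, regular off its closed fibre, is FULL-ified by one fibre-supported blowing up» — THE OPEN HALF at the
  registered level (res-L1-w45a-idea-1/idea-2's closed-point specimens are its instances at `I` Cartier);
* `localFullificationFibreClosedGe4_iff_split : (LF_cl) ↔ (LF_cl-CM) ∧ (LF_cl-F)` — PROVED exactly as in p587643 (`d` and the closedness of `x`
  carried along: Macaulayfy by `𝓚₁`, `Bl_{𝓚₁} S′` is again a blowing up of `Spec 𝒪_{X,x}` (080B) along a non-zero centre, regular off its closed
  fibre and CM everywhere, F-injectivise by `𝓚₂`, compose (080B, `T :=` closed fibre), transport FULL along `IsBlowup.unique`);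
* `localMacaulayficationDimFourFibre_imp_closed` / `localFInjectivizationDimFourFibre_imp_closed` — the d = 4 halves of p587643 imply the `d = 4`
  slices of the (LF_cl) halves (closedness is an extra HYPOTHESIS here).
≤ S bookkeeping: (LF_cl-F) ≤ (LF_cl) ≤ (LF) ≤ S_loc by the ⇒ direction and p588526's comparison.
[candidate statements, OURS; cite: Cesnavicius2021, Thm. 1.6 and Thm. 5.3 (CM-half, context); StacksProject, Tag 080B; Tag 085U]
-/

-- single-problem summit: the doubled namespace component is forced
set_option linter.dupNamespace false

noncomputable section

open AlgebraicGeometry CategoryTheory CategoryTheory.Limits Literature.AlgebraicGeometry.Resolution TopologicalSpace IsLocalRing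

namespace Summit.ResolutionOfSingularities.ResolutionOfSingularities.Theorems.FInjectiveMacaulayfication.LocalFullificationFibreClosedGe4Split

open Summit.ResolutionOfSingularities.ResolutionOfSingularities.Theorems.FInjectiveMacaulayfication
open SliceableCentre

/-! ## §1 The two halves -/

/-- [OURS · CANDIDATE statement, not a fact] **(LF_cl-CM) LOCAL MACAULAYFICATION AT CLOSED POINTS OF LOCAL DIMENSION `d ≥ 4`, FIBRE-SUPPORTED
CENTRE.** Same data as (LF_cl) `LocalFullificationFibreClosedGe4` (binders verbatim): `d ≥ 4`, `X/k` integral separated of finite type (`char k = p`),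
CLOSED `x ∈ X` with `dim 𝒪_{X,x} = d`,
`g : S′ → Spec 𝒪_{X,x}` a blowing up along `I ≠ ⊥`, `S′` regular off the closed fibre. Conclusion: an ideal sheaf `𝓚 ≠ ⊥` on `S′` supported in the
closed fibre such that EVERY blowing up `S″ → S′` along `𝓚` has, at EVERY point, a stalk that is a DOMAIN satisfying the CM-clause
(`SliceableCentre.CMCl`: every system of parameters weakly regular). An instance of Česnavičius's Macaulayfication in blow-up form (centre disjoint
from the CM locus, which contains the complement of the closed fibre) — known in print, candidate-tagged here until a named fact is filed.
[candidate statement, OURS; cite: Cesnavicius2021, Thm. 1.6 and Thm. 5.3 (context)] -/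
@[conjecture] def LocalMacaulayficationFibreClosedGe4 : Prop :=
  ∀ d : ℕ, 4 ≤ d →
  ∀ (p : ℕ), p.Prime → ∀ (k : Type) [Field k] [CharP k p]
    (X : Scheme.{0}) (f : X ⟶ Spec (.of k)),
      IsSeparated f → LocallyOfFiniteType f → QuasiCompact f → IsIntegral X →
      ∀ x : X, IsClosed ({x} : Set X) → ringKrullDim (X.presheaf.stalk x) = d →
      ∀ (S' : Scheme.{0}) (g : S' ⟶ Spec (X.presheaf.stalk x)) (I : (Spec (X.presheaf.stalk x)).IdealSheafData),
        I ≠ ⊥ → IsBlowup g I →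
        (∀ s : S', g.base s ≠ closedPoint (X.presheaf.stalk x) → s ∈ Scheme.regularLocus S') →
        ∃ 𝓚 : S'.IdealSheafData, 𝓚 ≠ ⊥ ∧ (∀ s ∈ (𝓚.support : Set S'), g.base s = closedPoint (X.presheaf.stalk x)) ∧
          ∀ (S'' : Scheme.{0}) (π : S'' ⟶ S'), IsBlowup π 𝓚 →
            ∀ s : S'', IsDomain (S''.presheaf.stalk s) ∧ CMCl (S''.presheaf.stalk s)

/-- [OURS · CANDIDATE statement, not a fact] **(LF_cl-F) LOCAL F-INJECTIVISATION OF A COHEN–MACAULAY LOCAL BLOW-UP SCHEME OVER A CLOSED POINT OF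
LOCAL DIMENSION `d ≥ 4`, FIBRE-SUPPORTED CENTRE.** (LF_cl) `LocalFullificationFibreClosedGe4` with ONE extra hypothesis: `S′` satisfies the CM-clause at
every point. I.e. for `d ≥ 4`, `X/k`, CLOSED `x` (`dim 𝒪_{X,x} = d`), `g : S′ → Spec 𝒪_{X,x}` a blowing up along `I ≠ ⊥`, `S′` regular off the closed fibre AND Cohen–Macaulay everywhere:
there is `𝓚 ≠ ⊥` supported in the closed fibre such that every blowing up of `S′` along `𝓚` is FULL (`SliceableCentre.FullCl`: domain ∧ CM-clause ∧
Frobenius-closed parameter ideals) at every point. THE OPEN HALF of the registered residue (LF_cl) of door v36. [candidate statement, OURS; open] -/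
@[conjecture] def LocalFInjectivizationFibreClosedGe4 : Prop :=
  ∀ d : ℕ, 4 ≤ d →
  ∀ (p : ℕ), p.Prime → ∀ (k : Type) [Field k] [CharP k p]
    (X : Scheme.{0}) (f : X ⟶ Spec (.of k)),
      IsSeparated f → LocallyOfFiniteType f → QuasiCompact f → IsIntegral X →
      ∀ x : X, IsClosed ({x} : Set X) → ringKrullDim (X.presheaf.stalk x) = d →
      ∀ (S' : Scheme.{0}) (g : S' ⟶ Spec (X.presheaf.stalk x)) (I : (Spec (X.presheaf.stalk x)).IdealSheafData),
        I ≠ ⊥ → IsBlowup g I →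
        (∀ s : S', g.base s ≠ closedPoint (X.presheaf.stalk x) → s ∈ Scheme.regularLocus S') →
        (∀ s : S', CMCl (S'.presheaf.stalk s)) →
        ∃ 𝓚 : S'.IdealSheafData, 𝓚 ≠ ⊥ ∧ (∀ s ∈ (𝓚.support : Set S'), g.base s = closedPoint (X.presheaf.stalk x)) ∧
          ∀ (S'' : Scheme.{0}) (π : S'' ⟶ S'), IsBlowup π 𝓚 →
            ∀ s : S'', FullCl p (S''.presheaf.stalk s)

/-! ## §2 (LF_cl) ⇒ each half -/

/-- (LF_cl) ⇒ (LF_cl-CM): FULL stalks are domains satisfying the CM-clause. [folklore] -/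
theorem localMacaulayficationFibreClosedGe4_of_localFullificationFibreClosedGe4
    (h : LocalFullificationFibreClosedGe4.LocalFullificationFibreClosedGe4) : LocalMacaulayficationFibreClosedGe4 := by
  intro d hd p hp k _ _ X f hsep hft hqc hint x hxcl hx S' g I hI hg hreg
  obtain ⟨𝓚, h1, h2, h3⟩ := h d hd p hp k X f hsep hft hqc hint x hxcl hx S' g I hI hg hreg
  exact ⟨𝓚, h1, h2, fun S'' π hπ s => ⟨(h3 S'' π hπ s).1, RelClosedSubsetFixFinite.cmCl_of_fullCl (h3 S'' π hπ s)⟩⟩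

/-- (LF_cl) ⇒ (LF_cl-F): drop the Cohen–Macaulay hypothesis. [folklore] -/
theorem localFInjectivizationFibreClosedGe4_of_localFullificationFibreClosedGe4
    (h : LocalFullificationFibreClosedGe4.LocalFullificationFibreClosedGe4) : LocalFInjectivizationFibreClosedGe4 := by
  intro d hd p hp k _ _ X f hsep hft hqc hint x hxcl hx S' g I hI hg hreg _
  exact h d hd p hp k X f hsep hft hqc hint x hxcl hx S' g I hI hg hreg

/-! ## §3 The two halves ⇒ (LF_cl): Macaulayfy, then F-injectivise, and compose the two blowings up -/

set_option maxHeartbeats 800000 in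
-- two blow-up existence calls, one 080B composite, one uniqueness transport
/-- **(LF_cl-CM) ∧ (LF_cl-F) ⇒ (LF_cl).** See the module docstring for the proof. [folklore assembly; cite: StacksProject, Tag 080B; Tag 085U] -/
theorem localFullificationFibreClosedGe4_of_split
    (hCM : LocalMacaulayficationFibreClosedGe4) (hF : LocalFInjectivizationFibreClosedGe4) :
    LocalFullificationFibreClosedGe4.LocalFullificationFibreClosedGe4 := by
  intro d hd p hp k _ _ X f hsep hft hqc hint x hxcl hx S' g I hI hg hreg
  classical
  haveI : IsLocallyNoetherian X := LocallyOfFiniteType.isLocallyNoetherian f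
  haveI : IsIntegral S' := hg.isIntegral hI
  haveI : IsProper g := hg.isProper
  haveI : IsLocallyNoetherian S' := LocallyOfFiniteType.isLocallyNoetherian g
  haveI : CompactSpace S' := QuasiCompact.compactSpace_of_compactSpace g
  haveI : IsNoetherian S' := {}
  -- Step 1: Macaulayfy `S'` along a fibre-supported `𝓚₁`
  obtain ⟨𝓚₁, h𝓚₁ne, h𝓚₁fib, h𝓚₁cm⟩ := hCM d hd p hp k X f hsep hft hqc hint x hxcl hx S' g I hI hg hreg
  obtain ⟨S₁, π₁, hπ₁⟩ := exists_isBlowup S' 𝓚₁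
  haveI : IsIntegral S₁ := hπ₁.isIntegral h𝓚₁ne
  haveI : IsProper π₁ := hπ₁.isProper
  haveI : IsLocallyNoetherian S₁ := LocallyOfFiniteType.isLocallyNoetherian π₁
  haveI : CompactSpace S₁ := QuasiCompact.compactSpace_of_compactSpace π₁
  haveI : IsNoetherian S₁ := {}
  -- `S₁ → Spec 𝒪_{X,x}` is again a blowing up, along a non-zero centre (080B)
  obtain ⟨I₁, hI₁, -⟩ := hg.exists_isBlowup_comp_supported g I π₁ 𝓚₁ Set.univ (Set.subset_univ _) hπ₁
    (by rw [Set.preimage_univ]; exact Set.subset_univ _)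
  have hI₁ne : I₁ ≠ ⊥ := RegularBlowupModelDim2.ne_bot_of_isBlowup hI₁
  -- the composite structure map, pointwise
  have hcomp : ∀ s : S₁, (π₁ ≫ g).base s = g.base (π₁.base s) := fun s => by
    rw [Scheme.Hom.comp_apply]
  -- `S₁` is regular off its closed fibre: `π₁` is a local isomorphism off `supp 𝓚₁ ⊆` (closed fibre of `S'`)
  have hreg₁ : ∀ s : S₁, (π₁ ≫ g).base s ≠ closedPoint (X.presheaf.stalk x) → s ∈ Scheme.regularLocus S₁ := by
    intro s hs
    rw [hcomp] at hs
    have hs' : π₁.base s ∉ (𝓚₁.support : Set S') := fun h => hs (h𝓚₁fib _ h)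
    haveI := hπ₁.isIso_compl
    exact (mem_regularLocus_iff_of_isIso_morphismRestrict π₁ ⟨(𝓚₁.support : Set S')ᶜ, 𝓚₁.support.isClosed.isOpen_compl⟩ s hs').mpr
      (hreg _ hs)
  -- `S₁` is Cohen–Macaulay everywhere
  have hcm₁ : ∀ s : S₁, CMCl (S₁.presheaf.stalk s) := fun s => (h𝓚₁cm S₁ π₁ hπ₁ s).2
  -- Step 2: F-injectivise `S₁` along a fibre-supported `𝓚₂`
  obtain ⟨𝓚₂, h𝓚₂ne, h𝓚₂fib, h𝓚₂full⟩ := hF d hd p hp k X f hsep hft hqc hint x hxcl hx S₁ (π₁ ≫ g) I₁ hI₁ne hI₁ hreg₁ hcm₁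
  obtain ⟨S₂, π₂, hπ₂⟩ := exists_isBlowup S₁ 𝓚₂
  haveI : IsIntegral S₂ := hπ₂.isIntegral h𝓚₂ne
  -- Step 3: the composite `S₂ → S₁ → S'` is a blowing up of `S'` along a FIBRE-SUPPORTED `𝓚 ≠ ⊥` (080B with `T :=` the closed fibre)
  obtain ⟨𝓚, h𝓚, h𝓚T⟩ := hπ₁.exists_isBlowup_comp_supported π₁ 𝓚₁ π₂ 𝓚₂
    {s : S' | g.base s = closedPoint (X.presheaf.stalk x)} (fun s hs => h𝓚₁fib s hs) hπ₂
    (fun s hs => by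
      have h := h𝓚₂fib s hs
      rw [hcomp] at h
      exact h)
  have h𝓚ne : 𝓚 ≠ ⊥ := RegularBlowupModelDim2.ne_bot_of_isBlowup h𝓚
  refine ⟨𝓚, h𝓚ne, fun s hs => h𝓚T hs, fun S'' π hπ s => ?_⟩
  -- Step 4: every blowing up along `𝓚` is `S₂` up to an isomorphism over `S'`; FULL transports along stalk isomorphisms
  obtain ⟨e, -, -⟩ := hπ.unique h𝓚
  exact FTemkinClosedPoints.fullCl_of_isIso_stalkMap' p e.hom s (h𝓚₂full S₂ π₂ hπ₂ (e.hom s))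

/-- **(LF_cl) ⟺ (LF_cl-CM) ∧ (LF_cl-F)**: the registered residue of door v36 is EXACTLY «fibre-supported local Macaulayfication at closed points
(known in print)» plus «fibre-supported local F-injectivisation of Cohen–Macaulay local blow-up schemes over closed points (open)». [folklore assembly] -/
theorem localFullificationFibreClosedGe4_iff_split :
    LocalFullificationFibreClosedGe4.LocalFullificationFibreClosedGe4 ↔
      LocalMacaulayficationFibreClosedGe4 ∧ LocalFInjectivizationFibreClosedGe4 :=
  ⟨fun h => ⟨localMacaulayficationFibreClosedGe4_of_localFullificationFibreClosedGe4 h,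
    localFInjectivizationFibreClosedGe4_of_localFullificationFibreClosedGe4 h⟩,
    fun h => localFullificationFibreClosedGe4_of_split h.1 h.2⟩


/-! ## §4 Comparison with the d = 4 split (p587643): closedness is extra HYPOTHESIS, so the d = 4 halves imply the (LF_cl) halves at `d = 4` -/

/-- (L4♭-CM) ⇒ the `d = 4` slice of (LF_cl-CM). [folklore] -/
theorem localMacaulayficationDimFourFibre_imp_closed (h : LocalFullificationDimFourFibreSplit.LocalMacaulayficationDimFourFibre) :
    ∀ (p : ℕ), p.Prime → ∀ (k : Type) [Field k] [CharP k p]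
    (X : Scheme.{0}) (f : X ⟶ Spec (.of k)),
      IsSeparated f → LocallyOfFiniteType f → QuasiCompact f → IsIntegral X →
      ∀ x : X, IsClosed ({x} : Set X) → ringKrullDim (X.presheaf.stalk x) = (4 : ℕ) →
      ∀ (S' : Scheme.{0}) (g : S' ⟶ Spec (X.presheaf.stalk x)) (I : (Spec (X.presheaf.stalk x)).IdealSheafData),
        I ≠ ⊥ → IsBlowup g I →
        (∀ s : S', g.base s ≠ closedPoint (X.presheaf.stalk x) → s ∈ Scheme.regularLocus S') →
        ∃ 𝓚 : S'.IdealSheafData, 𝓚 ≠ ⊥ ∧ (∀ s ∈ (𝓚.support : Set S'), g.base s = closedPoint (X.presheaf.stalk x)) ∧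
          ∀ (S'' : Scheme.{0}) (π : S'' ⟶ S'), IsBlowup π 𝓚 →
            ∀ s : S'', IsDomain (S''.presheaf.stalk s) ∧ CMCl (S''.presheaf.stalk s) :=
  fun p hp k _ _ X f hsep hft hqc hint x _ hx => h p hp k X f hsep hft hqc hint x (by exact_mod_cast hx)

/-- (L4♭-F) ⇒ the `d = 4` slice of (LF_cl-F). [folklore] -/
theorem localFInjectivizationDimFourFibre_imp_closed (h : LocalFullificationDimFourFibreSplit.LocalFInjectivizationDimFourFibre) :
    ∀ (p : ℕ), p.Prime → ∀ (k : Type) [Field k] [CharP k p]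
    (X : Scheme.{0}) (f : X ⟶ Spec (.of k)),
      IsSeparated f → LocallyOfFiniteType f → QuasiCompact f → IsIntegral X →
      ∀ x : X, IsClosed ({x} : Set X) → ringKrullDim (X.presheaf.stalk x) = (4 : ℕ) →
      ∀ (S' : Scheme.{0}) (g : S' ⟶ Spec (X.presheaf.stalk x)) (I : (Spec (X.presheaf.stalk x)).IdealSheafData),
        I ≠ ⊥ → IsBlowup g I →
        (∀ s : S', g.base s ≠ closedPoint (X.presheaf.stalk x) → s ∈ Scheme.regularLocus S') →
        (∀ s : S', CMCl (S'.presheaf.stalk s)) →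
        ∃ 𝓚 : S'.IdealSheafData, 𝓚 ≠ ⊥ ∧ (∀ s ∈ (𝓚.support : Set S'), g.base s = closedPoint (X.presheaf.stalk x)) ∧
          ∀ (S'' : Scheme.{0}) (π : S'' ⟶ S'), IsBlowup π 𝓚 →
            ∀ s : S'', FullCl p (S''.presheaf.stalk s) :=
  fun p hp k _ _ X f hsep hft hqc hint x _ hx => h p hp k X f hsep hft hqc hint x (by exact_mod_cast hx)

end Summit.ResolutionOfSingularities.ResolutionOfSingularities.Theorems.FInjectiveMacaulayfication.LocalFullificationFibreClosedGe4Split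

end
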